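import Summits.QuantumFields.YangMills.Theorems.BalabanLadderIRTwistedSlabOneBox
import Summits.QuantumFields.YangMills.Theorems.BalabanLadderIRTwistedSlabSpectralPurity
import Literature.Analysis.OperatorTheory.InvariantSectorSpectralTrace
import HarnessLib

/-!
# T1 AT ONE BOX, UNIFORMLY IN THE COUPLING: purity of the projected twisted slab at ONE time `t*` propagates to
# `projSlabDefect(β; ℓ, L, t) ≤ 2ρ^t` for ALL `t ≥ t*` — and a classical limit `< 1∕2` at `t*` makes it β-UNIFORM

HELPER toward stub **T1** `TwistedSlabAnchor` of LINE `twisted-slab-continuity` (crux `IRcof`, stmt-QuantumFields-26930, census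
row 43; LEAD prover ym-ir-line-tsc-p1 g5; `--supports` the crux, `--as helper`).  K35 of the T1-box programme: it combines
* K33 `Literature.Analysis.OperatorTheory.exists_spectralData_fluxSector_zero` — the e₂-flux-projected slab partition function is a
  GENUINE spectral trace, `projSlabZ(β; ℓ, L, M+2) = Σ_j ν_j(β)^{M+2}` with `ν_j ≥ 0` counted WITH multiplicity (eigenvalues of
  `P 𝕋_m P`, `P` = 't Hooft's e-flux projector, `𝕋_m` = the magnetically twisted transfer operator), and
* K34 `SpectralPurity.defect_le_two_mul_pow_of_defect_le` — purity propagation for such traces,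
into:
* §1 ★ `exists_spectralData_projSlabZ` — the spectral representation of `projSlabZ` (every compact `G`, continuous unitary `ρ`,
  `β ≥ 0`, central `z`, `z ^ n = 1`, every box);
* §2 ★★ `projSlabDefect_le_two_mul_pow_of_le` — **PURITY PROPAGATION ON THE LATTICE**: if `projSlabDefect(β; ℓ, L, t*) ≤ δ` with
  `0 ≤ δ < 1∕2` at ONE time `t* ≥ 2`, then `projSlabDefect(β; ℓ, L, t) ≤ 2·ρ^t` for EVERY `t ≥ t*`, `ρ = (δ∕(1−δ))^{1∕t*} < 1` — at
  the SAME `β`, with constants depending on `(δ, t*)` ONLY;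
* §3 ★★★ `twistedSlabAnchor_box_of_eventually_le` — **T1-BOX FROM ONE CLASSICAL NUMBER**: if for some `t* ≥ 2` and `δ < 1∕2` the
  defect at `t*` is eventually (in `β`) at most `δ` — e.g. because its `β → ∞` limit exists and is `< 1∕2` (K30b THE NUMBER + K31:
  `1 − ∏ tanh²(t*ω∕2) → 0`), `twistedSlabAnchor_box_of_tendsto` — then there are `β₀`, `c > 0`, `C` with
  `projSlabDefect(β; ℓ, L, t) ≤ C·e^{−ct}` for ALL `β ≥ β₀` and ALL `t ≥ 1`: T1's conclusion at one box, UNIFORM in the coupling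
  (the wall «M3 = β-uniform transfer-operator semiclassics» of the memo `Cruxes/IRcof/T1-ANATOMY-tsc-p1.md` is replaced by one
  Laplace-method number).

HONEST FRAMING: the rate `c = −t*⁻¹ log(δ∕(1−δ))` is β-independent but the admissible `t*` grows like `log L` (the classical defect
at `t*` is `≍ L·e^{−ωt*}`), so NOTHING here is uniform in `L`: T1 proper (`∃ β₀` BEFORE `∀ L`) still needs the L-uniform input (M4,
cluster expansion); the hypothesis of §3 is discharged for `SU(N)` only once K31 lands.  Nothing here proves `IRcof`, `IR`, or the
Yang–Mills mass gap (Clay: NOT proved); R4 = `BalabanLadder.UV` only.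

References: G. 't Hooft, Nucl. Phys. B 153 (1979) 141, §§4–5; M. Lüscher, Commun. Math. Phys. 54 (1977) 283; M. Reed, B. Simon IV
(1978) §XIII.12.
-/

set_option autoImplicit false

noncomputable section

open MeasureTheory Filter Function Finset Topology
open scoped BigOperators ENNReal ComplexConjugate
open Literature.Analysis.OperatorTheory Literature.MathematicalPhysics.QuantumFieldTheory

namespace Summit.QuantumFields.YangMills.Cruxes.IRcof.TwistedSlab

variable {G : Type*} [Group G] [TopologicalSpace G] [IsTopologicalGroup G] [CompactSpace G]
  [MeasurableSpace G] [BorelSpace G] [SecondCountableTopology G] {N : ℕ} {ρ : G →* Matrix (Fin N) (Fin N) ℂ}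

/-! ## §1 The projected twisted slab is a spectral trace with integer multiplicities -/

/-- ★ **Spectral representation of the e-flux-projected twisted slab**: for `β ≥ 0`, continuous unitary `ρ`, central `z` with
`z ^ (m+1) = 1` and every box `ℓ × ℓ × L` there is a family `ν_j ≥ 0` with `Σ ν_j² < ∞` and
`projSlabZ ρ β z (m+1) ℓ L (M+2) = Σ_j ν_j^{M+2}` for EVERY `M` — the eigenvalues, WITH multiplicity, of 't Hooft's `P(e₂ = 0) 𝕋_m`
(K33 `exists_spectralData_fluxSector_zero` on the magnetically twisted slice kernel of lit-4's `WilsonFinTorusMagneticSliceKernel`).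
[cite: tHooft1979Flux, §5 (5.1)–(5.4)] [cite: Luscher1977] -/
theorem exists_spectralData_projSlabZ (hρ : Continuous ρ) (hρu : ∀ g, ρ g ∈ Matrix.unitaryGroup (Fin N) ℂ)
    {β : ℝ} (hβ : 0 ≤ β) {z : G} (hz : z ∈ Subgroup.center G) {m : ℕ} (hzn : z ^ (m + 1) = 1) (ℓ L : ℕ) :
    ∃ (s : Set (Lp ℝ 2 (Measure.pi fun _ : FinSpatialSite ℓ ℓ L × Fin 3 => haarProbability G))) (ν : s → ℝ),
      (∀ j, 0 ≤ ν j) ∧ Summable (fun j => ν j ^ 2) ∧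
      ∀ M : ℕ, HasSum (fun j => ν j ^ (M + 2)) (projSlabZ ρ β z (m + 1) ℓ L (M + 2)) := by
  haveI : IsFiniteMeasure (haarProbability G) := by
    dsimp [haarProbability]; infer_instance
  set zM : Fin 4 → Fin 4 → G := slabMagTwist z with hzM
  set φ : ZMod (m + 1) → Fin 4 → G := slabElecTwist z (m + 1) with hφ
  have hφ0 : φ 0 = 1 := slabElecTwist_zero z (m + 1)
  have hφadd : ∀ k k', φ (k + k') = φ k * φ k' := slabElecTwist_add hzn
  have hφc : ∀ k (i : Fin 3), φ k i.castSucc ∈ Subgroup.center G := fun k i => slabElecTwist_castSucc_mem_center hz _ k i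
  obtain ⟨C, A, s, hcnt, b, lam, i₀, hC, hA, hb, -, -, -⟩ :=
    exists_eigenbasis_finTorusSliceKernelTw hρ hρu hβ (finSliceTwistTensor zM : FinSpatialSite ℓ ℓ L → Fin 3 → Fin 3 → G)
  haveI : Countable s := hcnt
  have hK := stronglyMeasurable_uncurry_finTorusSliceKernelTw (b₁ := ℓ) (b₂ := ℓ) (b₃ := L) ρ hρ β (finSliceTwistTensor zM)
  have hsymm : ∀ x y : FinSpatialSite ℓ ℓ L × Fin 3 → G,
      finTorusSliceKernelTw ρ β (finSliceTwistTensor zM) x y = finTorusSliceKernelTw ρ β (finSliceTwistTensor zM) y x :=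
    finTorusSliceKernelTw_symm ρ hρu β _
  have hT0 : (finSliceTwist (φ 0) : (FinSpatialSite ℓ ℓ L × Fin 3 → G) → _) = id := by
    rw [hφ0]; exact finSliceTwist_one
  have hTadd : ∀ (k k' : ZMod (m + 1)) (x : FinSpatialSite ℓ ℓ L × Fin 3 → G),
      finSliceTwist (φ (k + k')) x = finSliceTwist (φ k) (finSliceTwist (φ k') x) := fun k k' x => by
    rw [finSliceTwist_finSliceTwist, hφadd]
  have hT : ∀ k : ZMod (m + 1), MeasurePreserving (finSliceTwist (φ k) : (FinSpatialSite ℓ ℓ L × Fin 3 → G) → _)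
      (Measure.pi fun _ => haarProbability G) (Measure.pi fun _ => haarProbability G) :=
    fun k => measurePreserving_finSliceTwist (φ k)
  have hKT : ∀ (k : ZMod (m + 1)) (x y : FinSpatialSite ℓ ℓ L × Fin 3 → G),
      finTorusSliceKernelTw ρ β (finSliceTwistTensor zM) (finSliceTwist (φ k) x) (finSliceTwist (φ k) y) =
        finTorusSliceKernelTw ρ β (finSliceTwistTensor zM) x y :=
    fun k x y => finTorusSliceKernelTw_finSliceTwist ρ (hφc k) β _ x y
  have hzz : ∀ (k : ZMod (m + 1)) (M : ℕ),
      (fun k n => wilsonFinTorusTensorTwistedPartition ρ β (elecMagTwistTensor (φ k) zM) ℓ ℓ L n) k (M + 2) =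
      ∫ x, ((fun f : (FinSpatialSite ℓ ℓ L × Fin 3 → G) → ℝ => fun u =>
            ∫ y, finTorusSliceKernelTw ρ β (finSliceTwistTensor zM) u y * f y
              ∂(Measure.pi fun _ : FinSpatialSite ℓ ℓ L × Fin 3 => haarProbability G))^[M + 1]
          (fun y => finTorusSliceKernelTw ρ β (finSliceTwistTensor zM) y x)) (finSliceTwist (φ k) x)
        ∂(Measure.pi fun _ : FinSpatialSite ℓ ℓ L × Fin 3 => haarProbability G) :=
    fun k M => wilsonFinTorusTensorTwistedPartition_elecMag_eq_integral_iterate ρ hρ β (hφc k) zM ℓ ℓ L M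
  obtain ⟨s', ν, hν, hν2, hsum⟩ := exists_spectralData_fluxSector_zero (T := fun k => finSliceTwist (φ k)) hK hC hsymm
    (posType_finTorusSliceKernelTw ρ hρ hρu hβ _) hA hb hT hT0 hTadd hKT hzz
  refine ⟨s', ν, hν, hν2, fun M => ?_⟩
  have hre : projSlabZ ρ β z (m + 1) ℓ L (M + 2) =
      (Fintype.card (ZMod (m + 1)) : ℝ)⁻¹ * ∑ k : ZMod (m + 1),
        wilsonFinTorusTensorTwistedPartition ρ β (elecMagTwistTensor (φ k) zM) ℓ ℓ L (M + 2) := by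
    rw [projSlabZ_eq_re_magneticFluxPartition, wilsonFinTorusMagneticFluxPartition_def]
    exact re_fluxSector_zero_eq
      (fun k n => wilsonFinTorusTensorTwistedPartition ρ β (elecMagTwistTensor (φ k) zM) ℓ ℓ L n) (M + 2)
  rw [hre]
  exact hsum M

/-! ## §2 Purity propagation on the lattice (one `β`, one box; constants from `(δ, t*)` only) -/

/-- ★★ **PURITY AT ONE TIME PROPAGATES** (`β ≥ 0`, continuous unitary `ρ`, central `z`, `z ^ n = 1`, `n ≥ 1`, any box): if
`projSlabDefect ρ β z n ℓ L t* ≤ δ` with `0 ≤ δ < 1∕2` and `t* ≥ 2`, then for every `t ≥ t*`,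
`projSlabDefect ρ β z n ℓ L t ≤ 2·((δ∕(1−δ))^{1∕t*})^t`, and `0 ≤ (δ∕(1−δ))^{1∕t*} < 1`.  The constants do not see `β`, `ℓ`,
`L`: `δ < 1∕2` forces a simple top eigenvalue of `P 𝕋_m` and bounds every other eigenvalue ratio by `(δ∕(1−δ))^{1∕t*}`
(integer multiplicities, K33 + K34). [cite: tHooft1979Flux, §5 (5.1)] [cite: ReedSimonIV1978, Thm XIII.43 and Thm XIII.44] -/
theorem projSlabDefect_le_two_mul_pow_of_le (hρ : Continuous ρ) (hρu : ∀ g, ρ g ∈ Matrix.unitaryGroup (Fin N) ℂ)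
    {β : ℝ} (hβ : 0 ≤ β) {z : G} (hz : z ∈ Subgroup.center G) {n : ℕ} (hn : 0 < n) (hzn : z ^ n = 1) (ℓ L : ℕ)
    {ts : ℕ} (hts : 2 ≤ ts) {δ : ℝ} (hδ0 : 0 ≤ δ) (hδ : δ < 1 / 2) (hD : projSlabDefect ρ β z n ℓ L ts ≤ δ) :
    0 ≤ (δ / (1 - δ)) ^ (1 / (ts : ℝ)) ∧ (δ / (1 - δ)) ^ (1 / (ts : ℝ)) < 1 ∧
      ∀ t, ts ≤ t → projSlabDefect ρ β z n ℓ L t ≤ 2 * ((δ / (1 - δ)) ^ (1 / (ts : ℝ))) ^ t := by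
  obtain ⟨m, rfl⟩ : ∃ m, n = m + 1 := ⟨n - 1, by omega⟩
  obtain ⟨s, ν, hν, -, hsum⟩ := exists_spectralData_projSlabZ hρ hρu hβ hz hzn ℓ L
  -- the power sums `Z(t) = projSlabZ(t)` for `t ≥ 2`
  have hZ : ∀ t, 2 ≤ t → HasSum (fun j => ν j ^ t) (projSlabZ ρ β z (m + 1) ℓ L t) := fun t ht => by
    obtain ⟨M, rfl⟩ : ∃ M, t = M + 2 := ⟨t - 2, by omega⟩
    exact hsum M
  have hpos : 0 < projSlabZ ρ β z (m + 1) ℓ L ts := projSlabZ_pos ρ hρ β z (Nat.succ_pos m) ℓ L ts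
  have hD' : 1 - projSlabZ ρ β z (m + 1) ℓ L (2 * ts) / projSlabZ ρ β z (m + 1) ℓ L ts ^ 2 ≤ δ := hD
  obtain ⟨h0, h1, hmain⟩ := SpectralPurity.defect_le_two_mul_pow_of_defect_le (Z := fun t => projSlabZ ρ β z (m + 1) ℓ L t)
    (t₀ := 2) (ts := ts) hν hZ hts (by omega) hpos hδ0 hδ hD'
  exact ⟨h0, h1, fun t ht => hmain t ht⟩

/-! ## §3 T1-BOX: exponential purity at one box, UNIFORMLY in `β ≥ β₀`, from ONE eventual bound at `t*` -/

/-- ★★★ **T1-BOX FROM ONE CLASSICAL NUMBER.**  For `β`-INDEPENDENT data `t* ≥ 2`, `0 ≤ δ < 1∕2`: if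
`projSlabDefect ρ β z n ℓ L t* ≤ δ` for all `β ≥ β₁` (with `β₁ ≥ 0`), then with `c := −log max((δ∕(1−δ))^{1∕t*}, 1∕2) > 0` and
`C := 2·e^{c t*}` one has `projSlabDefect ρ β z n ℓ L t ≤ C·e^{−ct}` for ALL `β ≥ β₁` and ALL `t ≥ 1` — T1's conclusion at the box
`ℓ × ℓ × L`, uniformly in the coupling, with no transfer-operator semiclassics. [cite: tHooft1979Flux, §5 (5.1)–(5.4)]
[cite: ReedSimonIV1978, Thm XIII.43 and Thm XIII.44] -/
theorem twistedSlabAnchor_box_of_forall_le (hρ : Continuous ρ) (hρu : ∀ g, ρ g ∈ Matrix.unitaryGroup (Fin N) ℂ)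
    {z : G} (hz : z ∈ Subgroup.center G) {n : ℕ} (hn : 0 < n) (hzn : z ^ n = 1) (ℓ L : ℕ)
    {ts : ℕ} (hts : 2 ≤ ts) {δ : ℝ} (hδ0 : 0 ≤ δ) (hδ : δ < 1 / 2) {β₁ : ℝ} (hβ₁ : 0 ≤ β₁)
    (hD : ∀ β : ℝ, β₁ ≤ β → projSlabDefect ρ β z n ℓ L ts ≤ δ) :
    ∃ c C : ℝ, 0 < c ∧ 0 ≤ C ∧ ∀ β : ℝ, β₁ ≤ β → ∀ t : ℕ, 1 ≤ t →
      projSlabDefect ρ β z n ℓ L t ≤ C * Real.exp (-(c * (t : ℝ))) := by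
  set r : ℝ := (δ / (1 - δ)) ^ (1 / (ts : ℝ)) with hr
  set r' : ℝ := max r (1 / 2) with hr'
  have h1δ : 0 < 1 - δ := by linarith
  have hr0 : 0 ≤ r := Real.rpow_nonneg (div_nonneg hδ0 h1δ.le) _
  have hr'pos : 0 < r' := lt_of_lt_of_le (by norm_num) (le_max_right _ _)
  have hr1 : r < 1 := by
    have hS1 : δ / (1 - δ) < 1 := by rw [div_lt_one h1δ]; linarith
    exact Real.rpow_lt_one (div_nonneg hδ0 h1δ.le) hS1 (by positivity)
  have hr'1 : r' < 1 := max_lt hr1 (by norm_num)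
  set c : ℝ := -Real.log r' with hc
  have hcpos : 0 < c := by rw [hc, neg_pos]; exact Real.log_neg hr'pos hr'1
  have hexp : ∀ t : ℕ, r' ^ t = Real.exp (-(c * (t : ℝ))) := fun t => by
    rw [hc, neg_mul, neg_neg, mul_comm, Real.exp_nat_mul, Real.exp_log hr'pos]
  refine ⟨c, 2 * Real.exp (c * ts), hcpos, by positivity, fun β hβ t ht => ?_⟩
  have hβ0 : 0 ≤ β := hβ₁.trans hβ
  rcases Nat.lt_or_ge t ts with hlt | hge
  · -- `t < t*`: the defect is `≤ 1 ≤ 2 e^{c t*} e^{−c t}`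
    calc projSlabDefect ρ β z n ℓ L t ≤ 1 := projSlabDefect_le_one ρ β z n ℓ L t
      _ ≤ 2 * Real.exp (c * ts) * Real.exp (-(c * (t : ℝ))) := by
          rw [mul_assoc, ← Real.exp_add]
          have h : (0 : ℝ) ≤ c * ts + -(c * (t : ℝ)) := by
            have : (t : ℝ) ≤ ts := by exact_mod_cast hlt.le
            nlinarith
          nlinarith [Real.one_le_exp h]
  · obtain ⟨-, -, hmain⟩ := projSlabDefect_le_two_mul_pow_of_le hρ hρu hβ0 hz hn hzn ℓ L hts hδ0 hδ (hD β hβ)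
    calc projSlabDefect ρ β z n ℓ L t ≤ 2 * r ^ t := hmain t hge
      _ ≤ 2 * r' ^ t := by gcongr; exact le_max_left _ _
      _ = 2 * Real.exp (-(c * (t : ℝ))) := by rw [hexp]
      _ ≤ 2 * Real.exp (c * ts) * Real.exp (-(c * (t : ℝ))) := by
          have h1 : (1 : ℝ) ≤ Real.exp (c * ts) := Real.one_le_exp (by positivity)
          nlinarith [Real.exp_pos (-(c * (t : ℝ)))]

/-- ★★★ **T1-BOX FROM THE CLASSICAL LIMIT.**  If at some `t* ≥ 2` the projected defect has a `β → ∞` LIMIT `D* < 1∕2` (THE NUMBER,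
K24∕K30b: `D* = 1 − det_ℝΔ_{t*}² ∕ det_ℝΔ_{2t*}`; K31: `= 1 − ∏ tanh²(t*ω∕2) < 1∕2` for `t*` large), then there are `β₀`, `c > 0`,
`C ≥ 0` with `projSlabDefect ρ β z n ℓ L t ≤ C·e^{−ct}` for all `β ≥ β₀`, `t ≥ 1`.  HONEST: one box; `β₀` depends on the box;
nothing uniform in `L`. [cite: tHooft1979Flux, §5 (5.1)–(5.4)] -/
theorem twistedSlabAnchor_box_of_tendsto (hρ : Continuous ρ) (hρu : ∀ g, ρ g ∈ Matrix.unitaryGroup (Fin N) ℂ)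
    {z : G} (hz : z ∈ Subgroup.center G) {n : ℕ} (hn : 0 < n) (hzn : z ^ n = 1) (ℓ L : ℕ)
    {ts : ℕ} (hts : 2 ≤ ts) {D : ℝ} (hD : D < 1 / 2)
    (hlim : Tendsto (fun β : ℝ => projSlabDefect ρ β z n ℓ L ts) atTop (𝓝 D)) :
    ∃ β₀ c C : ℝ, 0 < c ∧ 0 ≤ C ∧ ∀ β : ℝ, β₀ ≤ β → ∀ t : ℕ, 1 ≤ t →
      projSlabDefect ρ β z n ℓ L t ≤ C * Real.exp (-(c * (t : ℝ))) := by
  -- `δ := max ((D + 1/2)/2) 0 ∈ [0, 1/2)` is eventually an upper bound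
  set δ : ℝ := max ((D + 1 / 2) / 2) 0 with hδdef
  have hδ0 : 0 ≤ δ := le_max_right _ _
  have hδ : δ < 1 / 2 := max_lt (by linarith) (by norm_num)
  have hDδ : D < δ := lt_of_lt_of_le (by linarith) (le_max_left _ _)
  have hev : ∀ᶠ β in atTop, projSlabDefect ρ β z n ℓ L ts ≤ δ :=
    (hlim.eventually (Iic_mem_nhds hDδ)).mono fun β h => h
  obtain ⟨β₁, hβ₁⟩ := (hev.and (eventually_ge_atTop 0)).exists_forall_of_atTop
  obtain ⟨c, C, hc, hC, h⟩ := twistedSlabAnchor_box_of_forall_le hρ hρu hz hn hzn ℓ L hts hδ0 hδ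
    (β₁ := max β₁ 0) (le_max_right _ _) fun β hβ => (hβ₁ β ((le_max_left _ _).trans hβ)).1
  exact ⟨max β₁ 0, c, C, hc, hC, h⟩

end Summit.QuantumFields.YangMills.Cruxes.IRcof.TwistedSlab

end
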